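import Summits.CriticalPhenomena.PercolationContinuityZ3.Theorems.PercNearOneGluingNoHeavyLowerTailSahiCTCLadderRowTwoSix
import HarnessLib

/-!
# `NoHeavyLowerTail` (crux stmt-CriticalPhenomena-4575), P3 lane: the row `#dbl = 2` of `(L_7)` (the signs discharged for `t = 7`)

Support file (seat `prim-l12-p3`, gen 26; `--supports stmt-CriticalPhenomena-4575`).  Memo g26 §4.16.  Same recipe as `…LadderRowTwoFour/Five/Six`:
`720·cH(7,k) = k⁶ − 9k⁵ + 55k⁴ − 75k³ + 304k² + 444k + 720`, closed forms in `ℚ`, Taylor positivity of the six multipliers at `n = 12`;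
**`coeff_ladder_seven_rowTwo_nonneg`**: row `#dbl = 2` of `(L_7)` for every profile with `τ = #(lev m 1) ≥ 17`.  Nothing is asserted
about the crux.
-/

namespace Summit.CriticalPhenomena.PercolationContinuityZ3.Theorems.SahiCTCForms

open Finset MvPolynomial SahiCTCGenFun SahiCTCWeightedLYM

variable {α : Type*} [DecidableEq α] [Fintype α]

omit [DecidableEq α] [Fintype α] in
/-- `720·cH(7,k) = k⁶ − 9k⁵ + 55k⁴ − 75k³ + 304k² + 444k + 720` for `k ≥ 13`. [this work] -/
theorem seventwenty_mul_cH_seven {k : ℕ} (hk : 13 ≤ k) :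
    720 * (cH 7 k : ℤ) = (k : ℤ) ^ 6 - 9 * (k : ℤ) ^ 5 + 55 * (k : ℤ) ^ 4 - 75 * (k : ℤ) ^ 3 + 304 * (k : ℤ) ^ 2 + 444 * k + 720 := by
  unfold cH
  rw [show min 7 (k + 1 - 7) = 7 from by omega]
  simp only [sum_range_succ, sum_range_zero, Nat.choose_zero_right, Nat.choose_one_right, zero_add, Nat.cast_add, Nat.cast_one]
  have h2 : (k.choose 2 : ℤ) * 2 = (k : ℤ) * (k - 1) := by
    have h := Nat.choose_two_right k
    have : k.choose 2 * 2 = k * (k - 1) := by rw [h]; exact Nat.div_mul_cancel (Nat.even_mul_pred_self k).two_dvd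
    have := congrArg (fun x : ℕ => (x : ℤ)) this; push_cast [Nat.cast_sub (show 1 ≤ k by omega)] at this; linarith
  have h3 : (k.choose 3 : ℤ) * 6 = (k : ℤ) * (k - 1) * (k - 2) := by
    have h := Nat.choose_succ_right_eq k 2
    have := congrArg (fun x : ℕ => (x : ℤ)) h; push_cast [Nat.cast_sub (show 2 ≤ k by omega)] at this
    nlinarith [this, h2]
  have h4 : (k.choose 4 : ℤ) * 24 = (k : ℤ) * (k - 1) * (k - 2) * (k - 3) := by
    have h := Nat.choose_succ_right_eq k 3
    have := congrArg (fun x : ℕ => (x : ℤ)) h; push_cast [Nat.cast_sub (show 3 ≤ k by omega)] at this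
    nlinarith [this, h3]
  have h5 : (k.choose 5 : ℤ) * 120 = (k : ℤ) * (k - 1) * (k - 2) * (k - 3) * (k - 4) := by
    have h := Nat.choose_succ_right_eq k 4
    have := congrArg (fun x : ℕ => (x : ℤ)) h; push_cast [Nat.cast_sub (show 4 ≤ k by omega)] at this
    nlinarith [this, h4]
  have h6 : (k.choose 6 : ℤ) * 720 = (k : ℤ) * (k - 1) * (k - 2) * (k - 3) * (k - 4) * (k - 5) := by
    have h := Nat.choose_succ_right_eq k 5
    have := congrArg (fun x : ℕ => (x : ℤ)) h; push_cast [Nat.cast_sub (show 5 ≤ k by omega)] at this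
    nlinarith [this, h5]
  nlinarith [h2, h3, h4, h5, h6]

/-- **ROW `#dbl = 2` OF `(L_7)`** (`τ ≥ 17`): the general certificate with its four signs discharged for `t = 7`. [this work] -/
theorem coeff_ladder_seven_rowTwo_nonneg {𝒳 𝒵 : Finset (Finset α)} (h𝒳 : IsUpperSet (𝒳 : Set (Finset α)))
    (h𝒵 : IsUpperSet (𝒵 : Set (Finset α))) (hX7 : ∀ S ∈ 𝒳, 7 ≤ #S) (hZ7 : ∀ S ∈ 𝒵, 7 ≤ #S)
    {m : α →₀ ℕ} (hm : ∀ i, m i ≤ 2) (hD : #(dbl m) = 2) (hτ : 17 ≤ #(lev m 1)) :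
    0 ≤ (ee 7 * (PiP * gf (𝒳 ∩ 𝒵) - gf 𝒳 * gf 𝒵) -
      gf (bySize (· ≤ 7 - 1) : Finset (Finset α)) * gf (bySize (7 ≤ ·) : Finset (Finset α)) *
        gf ((𝒳 ∩ 𝒵).filter fun S => #S = 7)).coeff m := by
  obtain ⟨n, hn⟩ : ∃ n : ℕ, #(lev m 1) + 2 = n + 7 := ⟨#(lev m 1) - 5, by omega⟩
  have hn12 : 12 ≤ n := by omega
  have e7 : 720 * (cH 7 (n + 1) : ℤ) = ((n : ℤ) + 1) ^ 6 - 9 * ((n : ℤ) + 1) ^ 5 + 55 * ((n : ℤ) + 1) ^ 4 - 75 * ((n : ℤ) + 1) ^ 3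
      + 304 * ((n : ℤ) + 1) ^ 2 + 444 * ((n : ℤ) + 1) + 720 := by
    have := seventwenty_mul_cH_seven (k := n + 1) (by omega); push_cast at this; linarith
  have e6 : 120 * (cH 6 (n + 1) : ℤ) = ((n : ℤ) + 1) ^ 5 - 5 * ((n : ℤ) + 1) ^ 4 + 25 * ((n : ℤ) + 1) ^ 3 + 5 * ((n : ℤ) + 1) ^ 2
      + 94 * ((n : ℤ) + 1) + 120 := by
    have := onetwenty_mul_cH_six (k := n + 1) (by omega); push_cast at this; linarith
  have e6' : 120 * (cH 6 (n - 1) : ℤ) = ((n : ℤ) - 1) ^ 5 - 5 * ((n : ℤ) - 1) ^ 4 + 25 * ((n : ℤ) - 1) ^ 3 + 5 * ((n : ℤ) - 1) ^ 2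
      + 94 * ((n : ℤ) - 1) + 120 := by
    obtain ⟨k, hk⟩ : ∃ k, n = k + 1 := ⟨n - 1, by omega⟩
    rw [hk, Nat.add_sub_cancel]; have := onetwenty_mul_cH_six (k := k) (by omega); push_cast; linarith
  have e5 : 24 * (cH 5 (n - 1) : ℤ) = ((n : ℤ) - 1) ^ 4 - 2 * ((n : ℤ) - 1) ^ 3 + 11 * ((n : ℤ) - 1) ^ 2 + 14 * ((n : ℤ) - 1) + 24 := by
    obtain ⟨k, hk⟩ : ∃ k, n = k + 1 := ⟨n - 1, by omega⟩
    rw [hk, Nat.add_sub_cancel]; have := twentyfour_mul_cH_five (k := k) (by omega); push_cast; linarith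
  have e5' : 24 * (cH 5 (n - 2) : ℤ) = ((n : ℤ) - 2) ^ 4 - 2 * ((n : ℤ) - 2) ^ 3 + 11 * ((n : ℤ) - 2) ^ 2 + 14 * ((n : ℤ) - 2) + 24 := by
    obtain ⟨k, hk⟩ : ∃ k, n = k + 2 := ⟨n - 2, by omega⟩
    rw [hk, Nat.add_sub_cancel]; have := twentyfour_mul_cH_five (k := k) (by omega); push_cast; linarith
  have q7 : ((cH 7 (n + 1) : ℕ) : ℚ) = (((n : ℚ) + 1) ^ 6 - 9 * ((n : ℚ) + 1) ^ 5 + 55 * ((n : ℚ) + 1) ^ 4 - 75 * ((n : ℚ) + 1) ^ 3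
      + 304 * ((n : ℚ) + 1) ^ 2 + 444 * ((n : ℚ) + 1) + 720) / 720 := by
    have h : (720 : ℚ) * ((cH 7 (n + 1) : ℕ) : ℚ) = ((n : ℚ) + 1) ^ 6 - 9 * ((n : ℚ) + 1) ^ 5 + 55 * ((n : ℚ) + 1) ^ 4 - 75 * ((n : ℚ) + 1) ^ 3
        + 304 * ((n : ℚ) + 1) ^ 2 + 444 * ((n : ℚ) + 1) + 720 := by exact_mod_cast e7
    linarith
  have q6 : ((cH 6 (n + 1) : ℕ) : ℚ) = (((n : ℚ) + 1) ^ 5 - 5 * ((n : ℚ) + 1) ^ 4 + 25 * ((n : ℚ) + 1) ^ 3 + 5 * ((n : ℚ) + 1) ^ 2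
      + 94 * ((n : ℚ) + 1) + 120) / 120 := by
    have h : (120 : ℚ) * ((cH 6 (n + 1) : ℕ) : ℚ) = ((n : ℚ) + 1) ^ 5 - 5 * ((n : ℚ) + 1) ^ 4 + 25 * ((n : ℚ) + 1) ^ 3
        + 5 * ((n : ℚ) + 1) ^ 2 + 94 * ((n : ℚ) + 1) + 120 := by exact_mod_cast e6
    linarith
  have q6' : ((cH 6 (n - 1) : ℕ) : ℚ) = (((n : ℚ) - 1) ^ 5 - 5 * ((n : ℚ) - 1) ^ 4 + 25 * ((n : ℚ) - 1) ^ 3 + 5 * ((n : ℚ) - 1) ^ 2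
      + 94 * ((n : ℚ) - 1) + 120) / 120 := by
    have h : (120 : ℚ) * ((cH 6 (n - 1) : ℕ) : ℚ) = ((n : ℚ) - 1) ^ 5 - 5 * ((n : ℚ) - 1) ^ 4 + 25 * ((n : ℚ) - 1) ^ 3
        + 5 * ((n : ℚ) - 1) ^ 2 + 94 * ((n : ℚ) - 1) + 120 := by exact_mod_cast e6'
    linarith
  have q5 : ((cH 5 (n - 1) : ℕ) : ℚ) = (((n : ℚ) - 1) ^ 4 - 2 * ((n : ℚ) - 1) ^ 3 + 11 * ((n : ℚ) - 1) ^ 2 + 14 * ((n : ℚ) - 1) + 24) / 24 := by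
    have h : (24 : ℚ) * ((cH 5 (n - 1) : ℕ) : ℚ) = ((n : ℚ) - 1) ^ 4 - 2 * ((n : ℚ) - 1) ^ 3 + 11 * ((n : ℚ) - 1) ^ 2 + 14 * ((n : ℚ) - 1) + 24 := by
      exact_mod_cast e5
    linarith
  have q5' : ((cH 5 (n - 2) : ℕ) : ℚ) = (((n : ℚ) - 2) ^ 4 - 2 * ((n : ℚ) - 2) ^ 3 + 11 * ((n : ℚ) - 2) ^ 2 + 14 * ((n : ℚ) - 2) + 24) / 24 := by
    have h : (24 : ℚ) * ((cH 5 (n - 2) : ℕ) : ℚ) = ((n : ℚ) - 2) ^ 4 - 2 * ((n : ℚ) - 2) ^ 3 + 11 * ((n : ℚ) - 2) ^ 2 + 14 * ((n : ℚ) - 2) + 24 := by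
      exact_mod_cast e5'
    linarith
  have hk : (0 : ℚ) ≤ (n : ℚ) - 12 := by
    have : ((12 : ℕ) : ℚ) ≤ n := by exact_mod_cast hn12
    push_cast at this; linarith
  have hk2 := mul_nonneg hk hk
  have hk3 := pow_nonneg hk 3
  have hk4 := pow_nonneg hk 4
  have hk5 := pow_nonneg hk 5
  have hk6 := pow_nonneg hk 6
  have hk7 := pow_nonneg hk 7
  have hk8 := pow_nonneg hk 8
  have hk9 := pow_nonneg hk 9
  have hk10 := pow_nonneg hk 10
  have hk11 := pow_nonneg hk 11
  have hk12 := pow_nonneg hk 12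
  have hk13 := pow_nonneg hk 13
  have hk14 := pow_nonneg hk 14
  have hk15 := pow_nonneg hk 15
  have hk16 := pow_nonneg hk 16
  have hk17 := pow_nonneg hk 17
  have hk18 := pow_nonneg hk 18
  refine coeff_ladder_rowTwoT_nonneg_of_signs h𝒳 h𝒵 (t := 7) (by norm_num) hX7 hZ7 hm hD hn (by omega) ?_ ?_ ?_ ?_ ?_ ?_
  all_goals
    first
    | refine Int.cast_nonneg_iff.1 (?_ : (0 : ℚ) ≤ _)
    | refine Int.cast_pos.1 (?_ : (0 : ℚ) < _)
  all_goals
    push_cast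
    simp only [q7, q6, q6', q5, q5']
    linarith only [hk, hk2, hk3, hk4, hk5, hk6, hk7, hk8, hk9, hk10, hk11, hk12, hk13, hk14, hk15, hk16, hk17, hk18]

end Summit.CriticalPhenomena.PercolationContinuityZ3.Theorems.SahiCTCForms
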